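import Summits.QuantumFields.YangMills.Theorems.FemtoTransferGapReduction
import Summits.QuantumFields.YangMills.Theorems.LuscherReductionRunningReductionTraceFormulaDefs
import HarnessLib

/-!
# Crux RED split, glue item `TraceDoorGlue` (stmt-QuantumFields-20206): the intermediate CURRENCIES of the TT door — definitions only

Route `LuscherReduction` (owner ym-beyond-p1), RED `RunningReduction` (stmt-QuantumFields-19978) split (route rev 11/12, g19) along
the twisted-trace door of the registered skeleton «KTR» rev 8 (`pub/ym-beyond/p1-g19-files/Lines-KTR-r8.lean`, sha16 4d4e029b06d8e70b)
into the children `TraceFormula` (20202) · `TwistedTraceScaling` (20203) · `OneSiteTail` (20204) · `DressedRitz` (20205) and the glue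
`TraceDoorGlue : TraceFormula → TwistedTraceScaling → OneSiteTail → DressedRitz → RunningReduction` (20206).

The glue is kernel-checked inside the skeleton (owner appendix `Lines-KTR-r8-splitcheck.lean`); landing it under `Theorems/` means
re-homing the skeleton's PARTS 2–3 (KT door algebra), 5 (TT objects and seams), 6 («INV» trace inversion) and 8 («OST») with the four
children as HYPOTHESES (the route decls `Summit.QuantumFields.YangMills.Theses.LuscherReduction.{TraceFormula, TwistedTraceScaling,
OneSiteTail, DressedRitz}` themselves — no restatement).  THIS FILE holds the definitions those parts quantify over, VERBATIM from the
skeleton (namespace moved from `…Cruxes.RunningReduction.{KT,TT,TT.Inv}` to `…Theorems.FemtoTransferGap.TraceDoor`):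

* TT objects (PART 5 §1): `traceRatio`, `femtoSteps`, `seqRatio`, `hTraceRatio`, `levelMoment`, `levelRatio` — over the TREE trace
  `FemtoTransferGap.TT.physTrace` (`Theorems/LuscherReductionRunningReductionTraceFormulaDefs.lean`), so that the route decl
  `TwistedTraceScaling` (which inlines `traceRatio`/`femtoSteps`) is `Iff.rfl`-equal to its `traceRatio` spelling.
* INV objects (PART 6 §6.1–6.2): relative levels `xval`, raw / regularised femto atoms `atomRaw` / `atomReg`, the dyadic femto-time grid
  `qgrid` and its approximants `qapprox`.

Deliberately NOT defined here: the skeleton's `Prop` currencies `CoarseNoIntruder`, `OneSiteLowerCoarse`, `CoarseLevels`,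
`OneSiteTraceLimit`, `TraceInversion` are SPELLED OUT as hypothesis / conclusion texts in the proof files (a `def … : Prop` under
`Theorems/` is reserved for named published facts); `TraceFormula`, `TwistedTraceScaling`, `OneSiteTail`, `DressedRitz`,
`RunningReduction`, `OneSiteLevels` are the ROUTE DECLS; `KatoTempleDoor` / `RitzBasics` are the tree THEOREMS
`KTDoorR3.katoTempleDoorR3` / `ritzBasicsR3`; `LevelGapSummable` is the tree theorem `LGS.levelGapSummable_all`.

HONEST FRAMING: bookkeeping definitions of the femto rung R2b1 (route leaf `FemtoGapOfRecord`); nothing here bears on infinite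
volume, the continuum limit or the Clay mass gap.  No instances, no notation, no axioms.
-/

set_option autoImplicit false

noncomputable section

open MeasureTheory Filter Topology Real
open scoped BigOperators

namespace Summit.QuantumFields.YangMills.Theorems.FemtoTransferGap.TraceDoor

open Summit.QuantumFields.YangMills.Theorems.FemtoTransferGap
open Summit.QuantumFields.YangMills.Theorems.FemtoTransferGap.TT (physTrace)

/-! ## §1 TT objects (skeleton PART 5 §1, VERBATIM over the tree trace `TT.physTrace`) -/

/-- **Vacuum-free dyadic trace ratio** `r(L, β, T) = Z_phys(2T)/Z_phys(T)²` (`Z_phys = TT.physTrace`, the closed zero-flux kernel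
chain): the extensive vacuum energy cancels identically; `r ∈ (0,1]` is the inverse effective number of states alive after Euclidean
time `T`. [cite: Luscher1983, §3] -/
def traceRatio (L : ℕ) [NeZero L] (β : ℝ) (T : ℕ) : ℝ :=
  physTrace L β (2 * T) / physTrace L β T ^ 2

/-- Number of lattice time steps spanning femto-time `s`: `T = ⌈s L/λ(β,L)⌉` (so `T/L = s/λ` spatial box lengths). -/
def femtoSteps (s β : ℝ) (L : ℕ) : ℕ := ⌈s * L / luscherLambda β L⌉₊

/-- Dyadic ratio functional of an energy sequence `x` at time `s`: `(Σ_k e^{−2s x_k})/(Σ_k e^{−s x_k})²`. -/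
def seqRatio (x : ℕ → ℝ) (s : ℝ) : ℝ :=
  (∑' k : ℕ, Real.exp (-(2 * s) * x k)) / (∑' k : ℕ, Real.exp (-s * x k)) ^ 2

/-- Lüscher's limiting ratio `r_𝔥(s) = Tr e^{−2s(𝔥−μ₁)}/(Tr e^{−s(𝔥−μ₁)})²` over the colour-invariant sector (`Δ_k = levelGap k`).
[cite: Luscher1983, §1] -/
def hTraceRatio (s : ℝ) : ℝ := seqRatio levelGap s

/-- **Level moments in units of the top value** (LEVEL currency, any lattice size; at `L = 1` the one-site model):
`m(L, β, T) = Σ_k (λ_k/λ_0)^T` (`tsum`; for `T ≥ 2` the series converges by `TraceFormula`). -/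
def levelMoment (L : ℕ) [NeZero L] (β : ℝ) (T : ℕ) : ℝ :=
  ∑' k : ℕ, (levelValue su2Rep L β k / levelValue su2Rep L β 0) ^ T

/-- Dyadic LEVEL ratio `m(2T)/m(T)²` (equals `traceRatio` wherever `TraceFormula` holds and `λ_0 > 0`). -/
def levelRatio (L : ℕ) [NeZero L] (β : ℝ) (T : ℕ) : ℝ :=
  levelMoment L β (2 * T) / levelMoment L β T ^ 2

/-! ## §2 INV objects (skeleton PART 6 §6.1–§6.2, VERBATIM) -/

/-- Relative level `x_j = λ_j/λ_0 ∈ [0,1]`. -/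
def xval (L : ℕ) [NeZero L] (β : ℝ) (j : ℕ) : ℝ :=
  levelValue su2Rep L β j / levelValue su2Rep L β 0

/-- Raw atom candidate `b_j`: `max(c·log(λ_0/λ_j), δ j)` on positive levels, `j/δ` on zero levels. -/
def atomRaw (L : ℕ) [NeZero L] (β c δ : ℝ) (j : ℕ) : ℝ :=
  if 0 < levelValue su2Rep L β j then
    max (c * Real.log (levelValue su2Rep L β 0 / levelValue su2Rep L β j)) (δ * j)
  else (j : ℝ) / δ

/-- Regularised atoms `ã_j = max_{i ≤ j} b_i` (monotone by construction). -/
def atomReg (L : ℕ) [NeZero L] (β c δ : ℝ) (j : ℕ) : ℝ :=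
  partialSups (atomRaw L β c δ) j

/-- Dyadic femto-time grid `q_i = (m+1)/2^p`, `i = ⟨m, p⟩` (dense in `(0, ∞)`). -/
def qgrid (i : ℕ) : ℝ := ((Nat.unpair i).1 + 1 : ℝ) / 2 ^ (Nat.unpair i).2

/-- The `m`-th dyadic approximant of `s > 0` from above, as a grid index. -/
def qapprox (s : ℝ) (m : ℕ) : ℕ := Nat.pair (⌈s * 2 ^ m⌉₊ - 1) m

end Summit.QuantumFields.YangMills.Theorems.FemtoTransferGap.TraceDoor

end
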